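import Summits.Ventures.YMGap.RobustBall.StringTensionExplicit
import HarnessLib

/-!
# Robust ball (Y2), area-law side — EXPLICIT STRING-TENSION FLOORS ON THE TIER-2 BALL (diameter-weighted, no range cut-off)

HONEST FRAMING: venture file of the cell `pub-ymgap` (QuantumFields programme), track ROBUST-BALL, seat rb-p2 (g4).  Tier-2 twin of
`StringTensionExplicit`: for the diameter-weighted ball `ClusterDomain κ ε₀ ε₁` (ds-4's `AreaLawOnBallW` currency, vertical window `mv`)
the weighted robust slab door (`slabCovarianceW_of_oneLinkKRModulus`, Föllmer's comparison) delivers slab clustering with EXPLICIT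
constants `(8N, τ)` for every `0 ≤ τ ≤ κ/n` satisfying the weighted row condition `e^{τ} e^{ε₀}(1 + 2√N ε₁)(2n|β/N|K) + √N ε₁ < 1`; run
through the FULL-RATE criterion (`abs_expectation_wilsonLoop_le_full_rate`) this gives, for every torus, member and loop,
`|⟨W_{R'×T}⟩_{β,W,L}| ≤ N (32N³)^T e^{−(τ/mv) R' T}` (the landed `areaLawOnBallW_of_oneLinkKRModulus` has the rate `κ/(2 n mv)`, existentially),
hence `HasAreaLawWith μ χ_N (32N³) (τ/mv)` for every infinite-volume limit state of every eventually-member family and string tension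
`σ ≥ τ/mv` whenever it exists; SU(2), `d = 4` cells on ds-4's certified tier-2 rows (`κ = log(6/5)`, `τ = κ/3`): `σ ≥ log(6/5)/(3 mv)`.
LATTICE, strong coupling; rates are door artefacts; existence of `σ` not claimed for non-Wilson members; nothing continuum / spectral / Clay.

References: H. Föllmer, LNM 1362 (1988) Ch. I Cor. (2.14); Cao–Nissim–Sheffield arXiv:2509.04688v2 Thm 2.3; E. Seiler, LNP 159 (1982) §2.
-/

noncomputable section

open MeasureTheory Filter Topology
open Literature.Probability.LatticeModels (Site)
open Literature.MathematicalPhysics.QuantumLattice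
open Literature.MathematicalPhysics.QuantumFieldTheory hiding ZdEdge Site
open Literature.MathematicalPhysics.QuantumFieldTheory.Balaban1983to89.StrongCouplingDobrushinWindow (OneLinkKRModulus)

namespace Summit.Ventures.YMGap.RobustBall

namespace StringTensionExplicitW

open StringTensionExplicit

variable {n N : ℕ}

/-- **EXPLICIT-RATE AREA LAW ON THE TIER-2 BALL** (tree coupling `β`, 't Hooft `β/N`): `N ≥ 2`, one-link modulus on the slab ball
`R ≥ 2n|β/N|`, weight `κ ≥ 0`, any `0 ≤ τ` with `τ n ≤ κ`, `0 ≤ ε₁`, vertical diameter `mv ≥ 1`, weighted row condition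
`e^{τ} e^{ε₀}(1 + 2√N ε₁)(2n|β/N|K) + √N ε₁ < 1`.  Then for every torus `L`, every `W ∈ ClusterDomain κ ε₀ ε₁` with `IsSlabLocal mv W` and
every loop with `2R', 2T ≤ L`: `|⟨W_{R'×T}⟩_{μ_{β,W,L}}| ≤ N · (32N³)^T · e^{−(τ/mv) R' T}`. [cite: Follmer1988, Ch. I Corollary (2.14)] -/
theorem abs_expectation_wilsonLoop_le_onBallW (hN : 2 ≤ N) (β : ℝ) {R K : ℝ} (hK : 0 ≤ K) (hmod : OneLinkKRModulus N R K)
    (hR : |β / N| * (2 * (n : ℝ)) ≤ R) {κ τ ε₀ ε₁ : ℝ} (hκ : 0 ≤ κ) (hτ : 0 ≤ τ) (hτκ : τ * n ≤ κ) (h₁ : 0 ≤ ε₁)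
    {mv : ℕ} (hmv : 1 ≤ mv)
    (hc : Real.exp τ * (Real.exp ε₀ * (1 + 2 * Real.sqrt N * ε₁) * (2 * (n : ℝ) * |β / N| * K)) + Real.sqrt N * ε₁ < 1)
    (L : ℕ) [NeZero L] (W : Perturbation (n + 1) L N) (hWball : W ∈ ClusterDomain κ ε₀ ε₁) (hWloc : IsSlabLocal mv W)
    (x : Literature.MathematicalPhysics.QuantumFieldTheory.Site (n + 1) L) {i j : Fin (n + 1)} (hij : i ≠ j) {R' T : ℕ}
    (hRL : 2 * R' ≤ L) (hTL : 2 * T ≤ L) :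
    |W.expectation (fundamentalRep (Fin N)) β (wilsonLoop (fundamentalRep (Fin N)) x i j R' T)| ≤
      N * (32 * (N : ℝ) ^ 3) ^ T * Real.exp (-(τ / mv) * ((R' : ℝ) * T)) := by
  have hNr : (N : ℝ) ≠ 0 := by exact_mod_cast (show N ≠ 0 by omega)
  have hN1 : (1 : ℝ) ≤ N := by exact_mod_cast (show 1 ≤ N by omega)
  have hβ : (N : ℝ) * (β / N) = β := by field_simp
  have hC₁ : (0 : ℝ) ≤ 8 * N := by positivity
  have h := abs_expectation_wilsonLoop_le_full_rate (n := n) (L := L) hN (β / N) W hmv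
    (fun v => hasVerticalRange_total_of_isSlabLocal hWloc v)
    (fun v t U => total_slabRotate_centre_of_isSlabLocal (by omega) hWloc v t U) hC₁ hτ
    (fun v t rest x' y' i' j' k' l' φ ψ hφ hψ =>
      slabCovarianceW_of_oneLinkKRModulus (n := n) (by omega) (β / N) hK hmod hR hκ hτ hτκ h₁ mv hc L W hWball hWloc v t
        rest x' y' i' j' k' l' φ ψ hφ hψ) x hij hRL hTL
  rw [hβ] at h
  have hmax : max (4 * (8 * (N : ℝ))) 1 = 32 * N := by rw [max_eq_left (by nlinarith)]; ring
  have hpow : (N : ℝ) ^ 2 * (32 * N) = 32 * (N : ℝ) ^ 3 := by ring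
  rw [hmax, hpow] at h
  exact h

/-- **EXPLICIT `ℤ^d` AREA LAW OF EVERY LIMIT STATE ON THE TIER-2 BALL** (same data, dimension `n + 1 ≥ 2`): every infinite-volume limit state
`μ` of every family eventually in `ClusterDomain κ ε₀ ε₁ ∩ IsSlabLocal mv` satisfies `HasAreaLawWith μ χ_N (32N³) (τ/mv)`. [folklore] -/
theorem hasAreaLawWith_onBallW_explicit (hN : 2 ≤ N) (hn : 1 ≤ n) (β : ℝ) {R K : ℝ} (hK : 0 ≤ K)
    (hmod : OneLinkKRModulus N R K) (hR : |β / N| * (2 * (n : ℝ)) ≤ R) {κ τ ε₀ ε₁ : ℝ} (hκ : 0 ≤ κ) (hτ : 0 ≤ τ)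
    (hτκ : τ * n ≤ κ) (h₁ : 0 ≤ ε₁) {mv : ℕ} (hmv : 1 ≤ mv)
    (hc : Real.exp τ * (Real.exp ε₀ * (1 + 2 * Real.sqrt N * ε₁) * (2 * (n : ℝ) * |β / N| * K)) + Real.sqrt N * ε₁ < 1)
    (𝓦 : PerturbationFamily (n + 1) N) (h𝓦 : ∀ᶠ L : ℕ in atTop, 𝓦 L ∈ ClusterDomain κ ε₀ ε₁ ∧ IsSlabLocal mv (𝓦 L))
    {μ : Measure (LGConfig (n + 1) (SUN N))} (hμ : μ ∈ perturbedLimitPoints β 𝓦) :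
    haveI : NeZero (n + 1) := ⟨by omega⟩
    HasAreaLawWith μ (fun g => normalisedCharacter N (fundamentalRep (Fin N) g)) (32 * (N : ℝ) ^ 3) (τ / mv) := by
  haveI : NeZero (n + 1) := ⟨by omega⟩
  have hN1 : (1 : ℝ) ≤ N := by exact_mod_cast (show 1 ≤ N by omega)
  have hND : (N : ℝ) ≤ 32 * (N : ℝ) ^ 3 := by
    have h3 : (N : ℝ) ≤ (N : ℝ) ^ 3 := le_self_pow₀ hN1 (by norm_num)
    nlinarith
  have h01 : (0 : Fin (n + 1)) ≠ 1 := fin_zero_ne_one_of_two_le (by omega)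
  refine hasAreaLawWith_of_torusBound (β := β) (fun L => {W | W ∈ ClusterDomain κ ε₀ ε₁ ∧ IsSlabLocal mv W})
    (fun L W hW R' T hR' _ hRL hTL => ?_) 𝓦 h𝓦 hμ
  have h := abs_expectation_wilsonLoop_le_onBallW (n := n) hN β hK hmod hR hκ hτ hτκ h₁ hmv hc (L + 1) W hW.1 hW.2
    (0 : Literature.MathematicalPhysics.QuantumFieldTheory.Site (n + 1) (L + 1)) h01 hRL hTL
  exact le_pow_perimeter_of_le hN1 hND (Real.exp_pos _).le hR' h

/-- **EXPLICIT STRING-TENSION FLOOR ON THE TIER-2 BALL**: every infinite-volume limit state of every family eventually in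
`ClusterDomain κ ε₀ ε₁ ∩ IsSlabLocal mv` has string tension `σ ≥ τ/mv` WHENEVER it exists, and static potential `V(R') ≥ (τ/mv) R' − log((32N³)²)`
wherever it exists (`R' ≥ 1`).  Existence is not asserted for non-Wilson members. [folklore] -/
theorem stringTension_ge_onBallW_explicit (hN : 2 ≤ N) (hn : 1 ≤ n) (β : ℝ) {R K : ℝ} (hK : 0 ≤ K)
    (hmod : OneLinkKRModulus N R K) (hR : |β / N| * (2 * (n : ℝ)) ≤ R) {κ τ ε₀ ε₁ : ℝ} (hκ : 0 ≤ κ) (hτ : 0 ≤ τ)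
    (hτκ : τ * n ≤ κ) (h₁ : 0 ≤ ε₁) {mv : ℕ} (hmv : 1 ≤ mv)
    (hc : Real.exp τ * (Real.exp ε₀ * (1 + 2 * Real.sqrt N * ε₁) * (2 * (n : ℝ) * |β / N| * K)) + Real.sqrt N * ε₁ < 1)
    (𝓦 : PerturbationFamily (n + 1) N) (h𝓦 : ∀ᶠ L : ℕ in atTop, 𝓦 L ∈ ClusterDomain κ ε₀ ε₁ ∧ IsSlabLocal mv (𝓦 L))
    {μ : Measure (LGConfig (n + 1) (SUN N))} (hμ : μ ∈ perturbedLimitPoints β 𝓦) :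
    haveI : NeZero (n + 1) := ⟨by omega⟩
    (∀ σ : ℝ, HasStringTension μ (fun g => normalisedCharacter N (fundamentalRep (Fin N) g)) σ → τ / mv ≤ σ) ∧
    (∀ (R' : ℕ) (V : ℝ), 1 ≤ R' → HasStaticPotential μ (fun g => normalisedCharacter N (fundamentalRep (Fin N) g)) R' V →
      τ / mv * R' - Real.log ((32 * (N : ℝ) ^ 3) ^ 2) ≤ V) := by
  haveI : NeZero (n + 1) := ⟨by omega⟩
  have hA := hasAreaLawWith_onBallW_explicit hN hn β hK hmod hR hκ hτ hτκ h₁ hmv hc 𝓦 h𝓦 hμ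
  exact ⟨fun σ hσ => hA.le_of_hasStringTension hσ,
    fun R' V hR' hV => linear_le_of_hasAreaLawWith_of_hasStaticPotential hA hR' hV⟩

/-! ### `SU(2)`, `d = 4` cells on ds-4's certified tier-2 rows (`κ = log(6/5)`, `τ = κ/3`) -/

/-- **SU(2), d = 4 tier-2 string-tension floor, schematic** (`K = 1` on radius `≤ 1`, `τ = κ/3`): under the weighted row condition
`e^{κ/3} e^{ε₀}(1 + 2√2 ε₁)(3β_W/2) + √2 ε₁ < 1`, every infinite-volume limit state of every family eventually in
`ClusterDomain κ ε₀ ε₁ ∩ IsSlabLocal mv` (tree coupling `β_W/2`) has string tension `σ ≥ κ/(3 mv)` whenever it exists. [folklore] -/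
theorem su2_stringTension_ge_onBallW_of_row {βW κ ε₀ ε₁ : ℝ} (hβ : 0 ≤ βW) (hβ1 : 3 * βW / 2 ≤ 1) (hκ : 0 < κ) (h₁ : 0 ≤ ε₁)
    {mv : ℕ} (hmv : 1 ≤ mv)
    (hrow : Real.exp (κ / 3) * (Real.exp ε₀ * (1 + 2 * Real.sqrt 2 * ε₁) * (3 * βW / 2)) + Real.sqrt 2 * ε₁ < 1)
    (𝓦 : PerturbationFamily 4 2) (h𝓦 : ∀ᶠ L : ℕ in atTop, 𝓦 L ∈ ClusterDomain κ ε₀ ε₁ ∧ IsSlabLocal mv (𝓦 L))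
    {μ : Measure (LGConfig 4 (SUN 2))} (hμ : μ ∈ perturbedLimitPoints (βW / 2) 𝓦) :
    ∀ σ : ℝ, HasStringTension μ (fun g => normalisedCharacter 2 (fundamentalRep (Fin 2) g)) σ → κ / (3 * mv) ≤ σ := by
  have hmod := SlabAreaLawDimensions.su2_oneLinkKRModulus_of_le_one (R := 3 * βW / 2) hβ1
  have habs : |βW / 2 / ((2 : ℕ) : ℝ)| = βW / 4 := by
    rw [abs_of_nonneg (by positivity)]; push_cast; ring
  have hτ : 0 ≤ κ / 3 := by positivity
  have hτκ : κ / 3 * ((3 : ℕ) : ℝ) ≤ κ := by push_cast; linarith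
  have hc : Real.exp (κ / 3) * (Real.exp ε₀ * (1 + 2 * Real.sqrt ((2 : ℕ) : ℝ) * ε₁) *
      (2 * ((3 : ℕ) : ℝ) * |βW / 2 / ((2 : ℕ) : ℝ)| * 1)) + Real.sqrt ((2 : ℕ) : ℝ) * ε₁ < 1 := by
    rw [habs]
    calc Real.exp (κ / 3) * (Real.exp ε₀ * (1 + 2 * Real.sqrt ((2 : ℕ) : ℝ) * ε₁) * (2 * ((3 : ℕ) : ℝ) * (βW / 4) * 1)) +
          Real.sqrt ((2 : ℕ) : ℝ) * ε₁
        = Real.exp (κ / 3) * (Real.exp ε₀ * (1 + 2 * Real.sqrt 2 * ε₁) * (3 * βW / 2)) + Real.sqrt 2 * ε₁ := by push_cast; ring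
      _ < 1 := hrow
  have h := (stringTension_ge_onBallW_explicit (n := 3) (N := 2) le_rfl (by norm_num) (βW / 2) zero_le_one hmod
    (by rw [habs]; push_cast; linarith) hκ.le hτ hτκ h₁ hmv hc 𝓦 h𝓦 hμ).1
  intro σ hσ
  have h' := h σ hσ
  have e : κ / 3 / ((mv : ℕ) : ℝ) = κ / (3 * mv) := by rw [div_div]
  rw [e] at h'
  exact h'

/-- ★ **SU(2), d = 4 tier-2 cell `(β⋆_W, κ, ε) = (1/3, log(6/5), 1/10)`** (ds-4's `su2_areaLawOnBallW_oneThird_w65` ball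
`ClusterDomain (log(6/5)) (1/5) (1/10)`, tree coupling `1/6`, every `mv ≥ 1`): every infinite-volume limit state of every eventually-member
family — infinite-range members included — has string tension `σ ≥ log(6/5)/(3 mv)` (`≥ 0.0607/mv`) whenever it exists. [folklore] -/
theorem su2_stringTension_ge_onBallW_oneThird_w65 {mv : ℕ} (hmv : 1 ≤ mv) (𝓦 : PerturbationFamily 4 2)
    (h𝓦 : ∀ᶠ L : ℕ in atTop, 𝓦 L ∈ ClusterDomain (Real.log (6 / 5)) (1 / 5) (1 / 10) ∧ IsSlabLocal mv (𝓦 L))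
    {μ : Measure (LGConfig 4 (SUN 2))} (hμ : μ ∈ perturbedLimitPoints (1 / 6) 𝓦) :
    ∀ σ : ℝ, HasStringTension μ (fun g => normalisedCharacter 2 (fundamentalRep (Fin 2) g)) σ →
      Real.log (6 / 5) / (3 * mv) ≤ σ := by
  have h6 : (1 / 6 : ℝ) = 1 / 3 / 2 := by norm_num
  rw [h6] at hμ
  refine su2_stringTension_ge_onBallW_of_row (βW := 1 / 3) (by norm_num) (by norm_num) (Real.log_pos (by norm_num)) (by norm_num)
    hmv ?_ 𝓦 h𝓦 hμ
  refine su2_rowW_lt_one_of_bounds (by norm_num) (by norm_num) exp_log_six_fifths_div_three_le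
    (exp_le_taylor4 (x := 1 / 5) (by norm_num) (by norm_num)) sqrt_two_le ?_
  norm_num

/-- ★ **SU(2), d = 4 tier-2 cell `(β⋆_W, κ, ε) = (1/8, log(6/5), 27/100)`** (ds-4's `su2_areaLawOnBallW_oneEighth_w65` ball
`ClusterDomain (log(6/5)) (27/50) (27/100)`, tree coupling `1/16`): `σ ≥ log(6/5)/(3 mv)` for every limit state of every eventually-member
family, whenever it exists. [folklore] -/
theorem su2_stringTension_ge_onBallW_oneEighth_w65 {mv : ℕ} (hmv : 1 ≤ mv) (𝓦 : PerturbationFamily 4 2)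
    (h𝓦 : ∀ᶠ L : ℕ in atTop, 𝓦 L ∈ ClusterDomain (Real.log (6 / 5)) (27 / 50) (27 / 100) ∧ IsSlabLocal mv (𝓦 L))
    {μ : Measure (LGConfig 4 (SUN 2))} (hμ : μ ∈ perturbedLimitPoints (1 / 16) 𝓦) :
    ∀ σ : ℝ, HasStringTension μ (fun g => normalisedCharacter 2 (fundamentalRep (Fin 2) g)) σ →
      Real.log (6 / 5) / (3 * mv) ≤ σ := by
  have h6 : (1 / 16 : ℝ) = 1 / 8 / 2 := by norm_num
  rw [h6] at hμ
  refine su2_stringTension_ge_onBallW_of_row (βW := 1 / 8) (by norm_num) (by norm_num) (Real.log_pos (by norm_num)) (by norm_num)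
    hmv ?_ 𝓦 h𝓦 hμ
  refine su2_rowW_lt_one_of_bounds (by norm_num) (by norm_num) exp_log_six_fifths_div_three_le
    (exp_le_taylor4 (x := 27 / 50) (by norm_num) (by norm_num)) sqrt_two_le ?_
  norm_num

/-- ★ **The Wilson member in the tier-2 currency: for SU(2), d = 4, `0 < β_W < 2/3`, every weight `κ ≥ 3τ > 0` with
`e^{τ}·(3β_W/2) < 1`:** `σ(μ) ≥ τ` for every infinite-volume limit state — i.e. every `τ < log(2/(3β_W))` (supremum = the tier-1 floor
`su2_stringTension_ge_log_dim4`). [folklore] -/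
theorem su2_wilson_stringTension_ge_of_weight {βW τ : ℝ} (hβ : 0 < βW) (hβ1 : 3 * βW / 2 ≤ 1) (hτ : 0 < τ)
    (hrow : Real.exp τ * (3 * βW / 2) < 1) {μ : Measure (LGConfig 4 (SUN 2))}
    (hμ : μ ∈ infiniteVolumeLimitPoints (fundamentalRep (Fin 2)) (βW / 2)) :
    τ ≤ stringTension μ (fun g => normalisedCharacter 2 (fundamentalRep (Fin 2) g)) := by
  have hρ := TorusAreaLaw.isSpecialUnitaryModel_fundamentalRep 2
  obtain ⟨-, hσ, -, -⟩ := WilsonStringTension.stringTension_le (d := 4) (fundamentalRep (Fin 2)) hρ le_rfl (by norm_num)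
    (by positivity) hμ
  have hmem : ∀ᶠ L : ℕ in atTop, (0 : PerturbationFamily 4 2) L ∈ ClusterDomain (3 * τ) 0 0 ∧
      IsSlabLocal 1 ((0 : PerturbationFamily 4 2) L) :=
    Eventually.of_forall fun L => ⟨zero_mem_clusterDomain le_rfl le_rfl, isSlabLocal_zero (n := 3) 1 (L + 1)⟩
  have hμ' : μ ∈ perturbedLimitPoints (βW / 2) (0 : PerturbationFamily 4 2) := by rwa [perturbedLimitPoints_zero]
  have h := su2_stringTension_ge_onBallW_of_row (κ := 3 * τ) (ε₀ := 0) (ε₁ := 0) hβ.le hβ1 (by positivity) le_rfl (mv := 1)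
    le_rfl ?_ 0 hmem hμ' _ hσ
  · have e : 3 * τ / (3 * ((1 : ℕ) : ℝ)) = τ := by push_cast; ring
    rw [e] at h
    exact h
  · have e : 3 * τ / 3 = τ := by ring
    rw [e]
    simpa using hrow

end StringTensionExplicitW

end Summit.Ventures.YMGap.RobustBall
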